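import Mathlib
import HarnessLib
import Literature.NumberTheory.Sieve.DivisorPowerSums
import Literature.NumberTheory.Sieve.BombieriFriedlanderIwaniecTheorem9SwitchCounting
import Summits.Parity.GeneralizedHardyLittlewood.Theorems.LiouvilleShiftedTablesEngineToPairsDefs

/-!
# `stub_TII_of_X1`, part 3: divisor bookkeeping and the band terms (line `Sketch`, crux `EngineToPairs`)

Third file of the Type-II leaf: the elementary estimates that control the separation of the product
condition `x/2 < mn ≤ x` by `(1+η)`-boxes in `m`.

* `tauPow B m = τ(m)^B` against the divisor power sums of `Literature/NumberTheory/Sieve/DivisorPowerSums`;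
* the BAND terms: for pairs `(m, n)` whose product falls in a set `K` of integers `k > h`,
  `∑_{q} ∑_{(m,n): mn ∈ K} τ(m)^B τ(n)^B |shiftWeight h q (mn)| ≤ ∑_{k ∈ K} τ(k − h) τ(k)^{2B+1}`
  (`band_sum_le`: `∑_q 1[q ∣ k − h] ≤ τ(k − h)`, `#{(m,n) : mn = k} ≤ τ(k)`, `τ(m), τ(n) ≤ τ(k)`),
  then Cauchy–Schwarz against `#K` and AM–GM (`band_sum_sq_le`);
* counting integers in the two bands `(x/2, (1+η)x/2] ∪ (x/(1+η), x]` (`card_band_le`);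
* `(log x)^p ≤ (p+1)^p x` (growth bookkeeping; `η/2 ≤ log (1+η)` and the `(1+η)`-adic blocks are
  `BFI.half_le_log_one_add`, `BFI.sum_Icc_floor_eq_sum_geomBlocks`, `BFI.exists_geomBlocks` of
  `Literature/NumberTheory/Sieve/BombieriFriedlanderIwaniecTheorem9SwitchCounting`).
-/

noncomputable section

namespace Summit.Parity.GeneralizedHardyLittlewood.Theorems.EngineToPairs

namespace TIIOfX1

open Finset Real
open scoped ArithmeticFunction.sigma

/-! ### `tauPow` and divisor sums -/

/-- `tauPow B m = τ(m)^B` with `τ = σ₀`. [folklore] -/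
theorem tauPow_eq_sigma (B m : ℕ) : tauPow B m = ((σ 0 m : ℕ) : ℝ) ^ B := by
  rw [tauPow, ArithmeticFunction.sigma_zero_apply]

/-- `1 ≤ τ(m)^B` for `m ≠ 0`. [folklore] -/
theorem one_le_tauPow (B : ℕ) {m : ℕ} (hm : m ≠ 0) : 1 ≤ tauPow B m := by
  rw [tauPow_eq_sigma]
  have : (1 : ℝ) ≤ ((σ 0 m : ℕ) : ℝ) := by
    exact_mod_cast Literature.NumberTheory.Sieve.one_le_sigma_zero hm
  exact one_le_pow₀ this

/-- `τ(m)^B ≤ τ(k)^B` for `m ∣ k ≠ 0`. [folklore] -/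
theorem tauPow_le_of_dvd (B : ℕ) {m k : ℕ} (hk : k ≠ 0) (hmk : m ∣ k) :
    tauPow B m ≤ tauPow B k := by
  rw [tauPow_eq_sigma, tauPow_eq_sigma]
  have : ((σ 0 m : ℕ) : ℝ) ≤ ((σ 0 k : ℕ) : ℝ) := by
    exact_mod_cast Literature.NumberTheory.Sieve.sigma_zero_le_of_dvd hk hmk
  exact pow_le_pow_left₀ (by positivity) this B

/-- Divisor-bounded coefficients on a subset of `[1, X]`: `∑ κ² ≤ ∑_{n ≤ X} τ(n)^{2B}`. [folklore] -/
theorem sum_sq_le_sum_sigma {B : ℕ} {κ : ℕ → ℝ} (hκ : ∀ n, |κ n| ≤ tauPow B n) {S : Finset ℕ}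
    {N : ℕ} (hS : S ⊆ Icc 1 N) :
    ∑ n ∈ S, κ n ^ 2 ≤ ∑ n ∈ Icc 1 N, ((σ 0 n : ℕ) : ℝ) ^ (2 * B) := by
  calc ∑ n ∈ S, κ n ^ 2 ≤ ∑ n ∈ S, ((σ 0 n : ℕ) : ℝ) ^ (2 * B) := by
        refine sum_le_sum fun n _ => ?_
        have h1 : κ n ^ 2 = |κ n| ^ 2 := (sq_abs _).symm
        rw [h1, pow_mul', ← tauPow_eq_sigma]
        exact pow_le_pow_left₀ (abs_nonneg _) (hκ n) 2
    _ ≤ ∑ n ∈ Icc 1 N, ((σ 0 n : ℕ) : ℝ) ^ (2 * B) :=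
        sum_le_sum_of_subset_of_nonneg hS fun _ _ _ => by positivity

/-- Same with the weight `1/n`: `∑ ξ²/m ≤ ∑_{m ≤ X} τ(m)^{2B}/m`. [folklore] -/
theorem sum_sq_div_le_sum_sigma {B : ℕ} {ξ : ℕ → ℝ} (hξ : ∀ m, |ξ m| ≤ tauPow B m) {S : Finset ℕ}
    {N : ℕ} (hS : S ⊆ Icc 1 N) :
    ∑ m ∈ S, ξ m ^ 2 / m ≤ ∑ m ∈ Icc 1 N, ((σ 0 m : ℕ) : ℝ) ^ (2 * B) / m := by
  calc ∑ m ∈ S, ξ m ^ 2 / m ≤ ∑ m ∈ S, ((σ 0 m : ℕ) : ℝ) ^ (2 * B) / m := by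
        refine sum_le_sum fun m _ => ?_
        have h1 : ξ m ^ 2 = |ξ m| ^ 2 := (sq_abs _).symm
        rw [h1, pow_mul', ← tauPow_eq_sigma]
        exact div_le_div_of_nonneg_right (pow_le_pow_left₀ (abs_nonneg _) (hξ m) 2)
          (by positivity)
    _ ≤ ∑ m ∈ Icc 1 N, ((σ 0 m : ℕ) : ℝ) ^ (2 * B) / m :=
        sum_le_sum_of_subset_of_nonneg hS fun _ _ _ => by positivity

/-! ### The band terms -/

/-- The moduli of the family catch `k` only through divisors of `k − h`:
`∑_{q ∈ Qs} |shiftWeight h q k| ≤ τ(k − h)` for `k > h`. [this line] -/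
theorem sum_abs_shiftWeight_le {h k : ℕ} (hk : h < k) (Qs : Finset ℕ) :
    ∑ q ∈ Qs, |shiftWeight h q k| ≤ ((σ 0 (k - h) : ℕ) : ℝ) := by
  have hkh : k - h ≠ 0 := by omega
  calc ∑ q ∈ Qs, |shiftWeight h q k| ≤ ∑ q ∈ Qs, (if q ∣ k - h then (1 : ℝ) else 0) := by
        refine sum_le_sum fun q _ => ?_
        unfold shiftWeight
        split_ifs with h1 h2 h2
        · rcases eq_or_ne (k - h) 0 with h0 | h0
          · exact absurd h0 hkh
          · rw [ArithmeticFunction.liouville_apply h0]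
            push_cast
            rw [abs_pow, abs_neg, abs_one, one_pow]
        · exact absurd ((Nat.modEq_iff_dvd' hk.le).1 h1.symm) h2
        · simp
        · simp
    _ = (((Qs.filter (fun q : ℕ => q ∣ k - h)).card : ℕ) : ℝ) := by
        rw [Finset.sum_boole]
    _ ≤ ((σ 0 (k - h) : ℕ) : ℝ) := by
        rw [ArithmeticFunction.sigma_zero_apply]
        exact_mod_cast Finset.card_le_card fun q hq =>
          Nat.mem_divisors.2 ⟨(Finset.mem_filter.1 hq).2, hkh⟩

/-- The multiplication table has at most `τ(k)` representations `k = mn`. [folklore] -/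
theorem card_mul_eq_le (Ms Ns : Finset ℕ) {k : ℕ} (hk : k ≠ 0) :
    ((Ms ×ˢ Ns).filter (fun p : ℕ × ℕ => p.1 * p.2 = k)).card ≤ σ 0 k := by
  have hsub : (Ms ×ˢ Ns).filter (fun p : ℕ × ℕ => p.1 * p.2 = k) ⊆ Nat.divisorsAntidiagonal k := by
    intro p hp
    rw [Nat.mem_divisorsAntidiagonal]
    exact ⟨(Finset.mem_filter.1 hp).2, hk⟩
  calc ((Ms ×ˢ Ns).filter (fun p : ℕ × ℕ => p.1 * p.2 = k)).card
      ≤ (Nat.divisorsAntidiagonal k).card := Finset.card_le_card hsub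
    _ = (Nat.divisors k).card := by rw [← Nat.map_div_right_divisors, Finset.card_map]
    _ = σ 0 k := (ArithmeticFunction.sigma_zero_apply k).symm

/-- **The band terms.** For moduli `Qs`, ranges `Ms, Ns`, a decidable condition `P` on the product
and a set `K ∋ mn` whenever `P(mn)`, all of whose elements exceed `h`:
`∑_q ∑_m ∑_{n : P(mn)} τ(m)^B τ(n)^B |shiftWeight h q (mn)| ≤ ∑_{k ∈ K} τ(k − h) τ(k)^{2B+1}`. [this line] -/
theorem band_sum_le (h B : ℕ) (Qs Ms Ns K : Finset ℕ) (P : ℕ → Prop) [DecidablePred P]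
    (hK : ∀ m ∈ Ms, ∀ n ∈ Ns, P (m * n) → m * n ∈ K) (hKh : ∀ k ∈ K, h < k) :
    ∑ q ∈ Qs, ∑ m ∈ Ms, ∑ n ∈ Ns.filter (fun n : ℕ => P (m * n)),
        tauPow B m * tauPow B n * |shiftWeight h q (m * n)| ≤
      ∑ k ∈ K, ((σ 0 (k - h) : ℕ) : ℝ) * tauPow (2 * B + 1) k := by
  -- move the `q`-sum inside and bound it by `τ(mn − h)`
  have step1 : ∑ q ∈ Qs, ∑ m ∈ Ms, ∑ n ∈ Ns.filter (fun n : ℕ => P (m * n)),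
        tauPow B m * tauPow B n * |shiftWeight h q (m * n)| ≤
      ∑ m ∈ Ms, ∑ n ∈ Ns.filter (fun n : ℕ => P (m * n)),
        tauPow B m * tauPow B n * ((σ 0 (m * n - h) : ℕ) : ℝ) := by
    rw [Finset.sum_comm]
    refine sum_le_sum fun m hm => ?_
    rw [Finset.sum_comm]
    refine sum_le_sum fun n hn => ?_
    rw [← mul_sum]
    obtain ⟨hn1, hn2⟩ := Finset.mem_filter.1 hn
    have hkh : h < m * n := hKh _ (hK m hm n hn1 hn2)
    exact mul_le_mul_of_nonneg_left (sum_abs_shiftWeight_le hkh Qs)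
      (mul_nonneg (tauPow_nonneg _ _) (tauPow_nonneg _ _))
  refine step1.trans ?_
  -- reindex by the product `k = mn ∈ K`
  set PP : Finset (ℕ × ℕ) := (Ms ×ˢ Ns).filter (fun p : ℕ × ℕ => P (p.1 * p.2)) with hPP
  have step2 : ∑ m ∈ Ms, ∑ n ∈ Ns.filter (fun n : ℕ => P (m * n)),
        tauPow B m * tauPow B n * ((σ 0 (m * n - h) : ℕ) : ℝ) =
      ∑ p ∈ PP, tauPow B p.1 * tauPow B p.2 * ((σ 0 (p.1 * p.2 - h) : ℕ) : ℝ) := by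
    rw [hPP, Finset.sum_filter, Finset.sum_product]
    refine sum_congr rfl fun m _ => ?_
    rw [Finset.sum_filter]
  rw [step2]
  have hmaps : ∀ p ∈ PP, p.1 * p.2 ∈ K := by
    intro p hp
    rw [hPP, Finset.mem_filter, Finset.mem_product] at hp
    exact hK _ hp.1.1 _ hp.1.2 hp.2
  rw [← Finset.sum_fiberwise_of_maps_to hmaps]
  refine sum_le_sum fun k hk => ?_
  have hk0 : k ≠ 0 := by have := hKh k hk; omega
  -- on the fibre `mn = k`: each term is at most `τ(k)^{2B} τ(k − h)`, and there are `≤ τ(k)` terms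
  have hterm : ∀ p ∈ PP.filter (fun p : ℕ × ℕ => p.1 * p.2 = k),
      tauPow B p.1 * tauPow B p.2 * ((σ 0 (p.1 * p.2 - h) : ℕ) : ℝ) ≤
        tauPow B k * tauPow B k * ((σ 0 (k - h) : ℕ) : ℝ) := by
    intro p hp
    obtain ⟨-, hpk⟩ := Finset.mem_filter.1 hp
    rw [hpk]
    have h1 : tauPow B p.1 ≤ tauPow B k := tauPow_le_of_dvd B hk0 ⟨p.2, hpk.symm⟩
    have h2 : tauPow B p.2 ≤ tauPow B k :=
      tauPow_le_of_dvd B hk0 ⟨p.1, by rw [mul_comm]; exact hpk.symm⟩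
    have h0 := tauPow_nonneg B p.1
    have h0' := tauPow_nonneg B p.2
    have h0k := tauPow_nonneg B k
    gcongr
  refine (sum_le_sum hterm).trans ?_
  rw [sum_const, nsmul_eq_mul]
  have hcard : (((PP.filter (fun p : ℕ × ℕ => p.1 * p.2 = k)).card : ℕ) : ℝ) ≤ ((σ 0 k : ℕ) : ℝ) := by
    have : PP.filter (fun p : ℕ × ℕ => p.1 * p.2 = k) ⊆
        (Ms ×ˢ Ns).filter (fun p : ℕ × ℕ => p.1 * p.2 = k) := by
      intro p hp
      rw [Finset.mem_filter] at hp ⊢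
      rw [hPP, Finset.mem_filter] at hp
      exact ⟨hp.1.1, hp.2⟩
    exact_mod_cast (Finset.card_le_card this).trans (card_mul_eq_le Ms Ns hk0)
  have hτ : tauPow (2 * B + 1) k = ((σ 0 k : ℕ) : ℝ) * (tauPow B k * tauPow B k) := by
    rw [tauPow_eq_sigma, tauPow_eq_sigma]; ring
  rw [hτ]
  have h0 : 0 ≤ tauPow B k * tauPow B k * ((σ 0 (k - h) : ℕ) : ℝ) := by
    have := tauPow_nonneg B k; positivity
  calc (((PP.filter (fun p : ℕ × ℕ => p.1 * p.2 = k)).card : ℕ) : ℝ) *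
        (tauPow B k * tauPow B k * ((σ 0 (k - h) : ℕ) : ℝ))
      ≤ ((σ 0 k : ℕ) : ℝ) * (tauPow B k * tauPow B k * ((σ 0 (k - h) : ℕ) : ℝ)) :=
        mul_le_mul_of_nonneg_right hcard h0
    _ = _ := by ring

/-- Cauchy–Schwarz against `#K` and AM–GM:
`(∑_{k ∈ K} τ(k − h) τ(k)^{2B+1})² ≤ #K · ∑_{k ∈ K} (τ(k − h)⁴ + τ(k)^{8B+4}) / 2`. [folklore] -/
theorem band_sum_sq_le (h B : ℕ) (K : Finset ℕ) :
    (∑ k ∈ K, ((σ 0 (k - h) : ℕ) : ℝ) * tauPow (2 * B + 1) k) ^ 2 ≤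
      (K.card : ℝ) * ∑ k ∈ K, ((((σ 0 (k - h) : ℕ) : ℝ)) ^ 4 +
        ((σ 0 k : ℕ) : ℝ) ^ (8 * B + 4)) / 2 := by
  refine (sq_sum_le_card_mul_sum_sq (s := K)
    (f := fun k => ((σ 0 (k - h) : ℕ) : ℝ) * tauPow (2 * B + 1) k)).trans ?_
  refine mul_le_mul_of_nonneg_left (sum_le_sum fun k _ => ?_) (by positivity)
  rw [tauPow_eq_sigma]
  -- `(a b)² ≤ (a⁴ + b⁴)/2` with `a = τ(k-h)`, `b = τ(k)^{2B+1}`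
  have key : ∀ a b : ℝ, (a * b) ^ 2 ≤ (a ^ 4 + b ^ 4) / 2 := by
    intro a b
    nlinarith [sq_nonneg (a ^ 2 - b ^ 2)]
  have := key (((σ 0 (k - h) : ℕ) : ℝ)) (((σ 0 k : ℕ) : ℝ) ^ (2 * B + 1))
  have e : (2 * B + 1) * 4 = 8 * B + 4 := by ring
  rw [← pow_mul, e] at this
  exact this

/-- Shifting the divisor sum: `∑_{k ∈ K} τ(k − h)⁴ ≤ ∑_{j ≤ N} τ(j)⁴` for `K ⊆ [1, N]`, `k > h` on `K`.
[folklore] -/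
theorem sum_sigma_shift_le (h : ℕ) {K : Finset ℕ} {N : ℕ} (hK : K ⊆ Icc 1 N)
    (hKh : ∀ k ∈ K, h < k) :
    ∑ k ∈ K, (((σ 0 (k - h) : ℕ) : ℝ)) ^ 4 ≤ ∑ j ∈ Icc 1 N, ((σ 0 j : ℕ) : ℝ) ^ 4 := by
  have hinj : Set.InjOn (fun k : ℕ => k - h) K := by
    intro k hk k' hk' he
    have h1 := hKh k hk
    have h2 := hKh k' hk'
    simp only at he
    omega
  rw [← Finset.sum_image (f := fun j => ((σ 0 j : ℕ) : ℝ) ^ 4) hinj]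
  refine sum_le_sum_of_subset_of_nonneg (fun j hj => ?_) (fun _ _ _ => by positivity)
  obtain ⟨k, hk, rfl⟩ := Finset.mem_image.1 hj
  have h1 := hKh k hk
  have h2 := Finset.mem_Icc.1 (hK hk)
  exact Finset.mem_Icc.2 ⟨by omega, by omega⟩

/-! ### Counting the bands -/

/-- Integers of `[1, N]` in a real interval `(a, b]`, `0 ≤ a ≤ b`: at most `b − a + 1`. [folklore] -/
theorem card_filter_Ioc_real_le (N : ℕ) {a b : ℝ} (ha : 0 ≤ a) (hab : a ≤ b) :
    ((((Icc 1 N).filter (fun k : ℕ => a < k ∧ (k : ℝ) ≤ b)).card : ℕ) : ℝ) ≤ b - a + 1 := by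
  have hsub : (Icc 1 N).filter (fun k : ℕ => a < k ∧ (k : ℝ) ≤ b) ⊆ Ioc ⌊a⌋₊ ⌊b⌋₊ := by
    intro k hk
    obtain ⟨-, h1, h2⟩ := Finset.mem_filter.1 hk
    exact Finset.mem_Ioc.2 ⟨(Nat.floor_lt ha).2 h1, Nat.le_floor h2⟩
  have hfl : ⌊a⌋₊ ≤ ⌊b⌋₊ := Nat.floor_le_floor hab
  calc ((((Icc 1 N).filter (fun k : ℕ => a < k ∧ (k : ℝ) ≤ b)).card : ℕ) : ℝ)
      ≤ (((Ioc ⌊a⌋₊ ⌊b⌋₊).card : ℕ) : ℝ) := by exact_mod_cast Finset.card_le_card hsub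
    _ = (⌊b⌋₊ : ℝ) - (⌊a⌋₊ : ℝ) := by rw [Nat.card_Ioc, Nat.cast_sub hfl]
    _ ≤ b - a + 1 := by
        have h1 : (⌊b⌋₊ : ℝ) ≤ b := Nat.floor_le (ha.trans hab)
        have h2 : a < (⌊a⌋₊ : ℝ) + 1 := Nat.lt_floor_add_one a
        linarith

/-- **The two bands are short**: for `η, x ≥ 0`,
`#{k ≤ x : x/2 < k ≤ (1+η)x/2 ∨ x/(1+η) < k ≤ x} ≤ 2ηx + 2`. [this line] -/
theorem card_band_le {x η : ℝ} (hx : 0 ≤ x) (hη : 0 ≤ η) :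
    ((((Icc 1 ⌊x⌋₊).filter (fun k : ℕ =>
        (x / 2 < k ∧ (k : ℝ) ≤ (1 + η) * x / 2) ∨ (x / (1 + η) < k ∧ (k : ℝ) ≤ x))).card : ℕ) : ℝ)
      ≤ 2 * η * x + 2 := by
  rw [Finset.filter_or]
  have h1 := card_filter_Ioc_real_le ⌊x⌋₊ (a := x / 2) (b := (1 + η) * x / 2) (by positivity)
    (by nlinarith)
  have h1η : 0 < 1 + η := by linarith
  have hxx : x / (1 + η) ≤ x := div_le_self hx (by linarith)
  have h2 := card_filter_Ioc_real_le ⌊x⌋₊ (a := x / (1 + η)) (b := x) (by positivity) hxx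
  have hgap : x - x / (1 + η) ≤ η * x := by
    have e : x - x / (1 + η) = η * x / (1 + η) := by field_simp; ring
    rw [e]
    exact div_le_self (by positivity) (by linarith)
  calc (((((Icc 1 ⌊x⌋₊).filter (fun k : ℕ => x / 2 < k ∧ (k : ℝ) ≤ (1 + η) * x / 2)) ∪
          ((Icc 1 ⌊x⌋₊).filter (fun k : ℕ => x / (1 + η) < k ∧ (k : ℝ) ≤ x))).card : ℕ) : ℝ)
      ≤ ((((Icc 1 ⌊x⌋₊).filter (fun k : ℕ => x / 2 < k ∧ (k : ℝ) ≤ (1 + η) * x / 2)).card : ℕ) : ℝ)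
        + ((((Icc 1 ⌊x⌋₊).filter (fun k : ℕ => x / (1 + η) < k ∧ (k : ℝ) ≤ x)).card : ℕ) : ℝ) := by
        exact_mod_cast Finset.card_union_le _ _
    _ ≤ ((1 + η) * x / 2 - x / 2 + 1) + (x - x / (1 + η) + 1) := add_le_add h1 h2
    _ ≤ 2 * η * x + 2 := by nlinarith

/-! ### Growth bookkeeping -/

/-- Powers of `log` are eventually small against `x`, with an explicit constant:
`(log x)^p ≤ (p+1)^p x` for `x ≥ 1`. [folklore] -/
theorem log_pow_le (p : ℕ) {x : ℝ} (hx : 1 ≤ x) : Real.log x ^ p ≤ ((p : ℝ) + 1) ^ p * x := by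
  have hL0 : 0 ≤ Real.log x := Real.log_nonneg hx
  have hx0 : 0 ≤ x := by linarith
  have hp1 : (0 : ℝ) < (p : ℝ) + 1 := by positivity
  have h1 := Real.log_le_rpow_div hx0 (inv_pos.2 hp1)
  rw [div_inv_eq_mul] at h1
  have h2 : Real.log x ^ p ≤ (x ^ ((p : ℝ) + 1)⁻¹ * ((p : ℝ) + 1)) ^ p := pow_le_pow_left₀ hL0 h1 p
  refine h2.trans ?_
  rw [mul_pow, mul_comm, ← Real.rpow_natCast (x ^ ((p : ℝ) + 1)⁻¹) p, ← Real.rpow_mul hx0]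
  refine mul_le_mul_of_nonneg_left ?_ (by positivity)
  calc x ^ (((p : ℝ) + 1)⁻¹ * (p : ℝ)) ≤ x ^ (1 : ℝ) := by
        refine Real.rpow_le_rpow_of_exponent_le hx ?_
        rw [inv_mul_le_iff₀ hp1]
        linarith
    _ = x := Real.rpow_one x

end TIIOfX1

/-- Anchor of part 3 of `stub_TII_of_X1`: the divisor weight is at least `1` off zero. [this line] -/
theorem tiiOfX1_part3_anchor : ∀ B m : ℕ, m ≠ 0 → 1 ≤ tauPow B m :=
  fun B _ hm => TIIOfX1.one_le_tauPow B hm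

end Summit.Parity.GeneralizedHardyLittlewood.Theorems.EngineToPairs

end
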